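import Summits.BirchSwinnertonDyer.BirchSwinnertonDyer.Theorems.AlignedTransportAtTwoMainConjectureOfRankZeroBSDAtTwoResolventTowerGenus
import Summits.BirchSwinnertonDyer.BirchSwinnertonDyer.Theorems.AlignedTransportAtTwoMainConjectureOfRankZeroBSDAtTwoResolventLambdaParitySeeds
import Literature.NumberTheory.IwasawaTheory.ImaginaryQuadraticTwoTowerRankStabilisation
import HarnessLib

/-!
# Route `AlignedTransportAtTwo`, crux C2 `MainConjectureOfRankZeroBSDAtTwo` (stmt-BirchSwinnertonDyer-22298):
# THE RESOLVENT TOWER MADE EXPLICIT — `rank₂ Cl(ℚ(√Δ_W)_n) = Σ_{ℓ ∣ d} 2^{min(n, ord₂(ℓ²−1)−3)} − 1`, its own rank certificate from `n₀ = max_ℓ (ord₂(ℓ²−1)−3)` on,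
# `λ₂(ℚ(√Δ_W)) ≤ Σ − 1` UNCONDITIONALLY, and `rank₂ Cl(ℚ(W[2])_n) ≥ Σ − 1` for `n ≥ n₀` (7831a1: `≥ 17` for `n ≥ 4`; 24213c1: `≥ 33` for `n ≥ 5`)

HONEST FRAMING (cell `bsd-f1-sign2`, WIDTH-5 attached prover seat `bsd-line-att-p3` gen 30, line `birth`, lead `bsd-line-att-p2`; `--supports`
stmt-BirchSwinnertonDyer-22298, closes nothing; BSD is NOT proved by any of this; the crux C2, its verdict «blocked-on `Rank1Residual.GreenbergMuConjectureIrreducible`»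
and every registered stub are untouched).  THEOREMS ONLY — no definition, no named fact, no `sorry`; NOTHING below is conditional (gen 29's seed floors
`λ₂(T) ≥ 17 / 33` needed `μ₂ = 0` AND the Ferrero–Kida named fact; the RANK floors below need neither).

THE INPUT (this seat's Literature files, gen 30): `CyclotomicTwoTowerOddPrimeSplitting` (ℓ splits completely in `ℚ_n` ⟺ `ℓ ≡ ±1 (mod 2^{n+2})`, residue-field
Frobenius in `ℤ[ζ]/𝔔`), `CyclotomicTwoTowerOddPrimeDecompositionExact` (`g_n(ℓ) = 2^{min(n, ord₂(ℓ²−1)−3)}` — stall-is-forever in a cyclic `2`-tower),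
`ImaginaryQuadraticTwoTowerRankStabilisation` (`rank₂ Cl(K_n) = Σ_{ℓ ∣ d_K} 2^{min(n, m_ℓ)} − 1`, stationary from `n₀`; Fukuda ⟹ `μ₂(K) = 0`, `λ₂(K) ≤ Σ − 1`).

THIS FILE (`W/ℚ` elliptic, `Δ_W = −d·q²` with `d ≡ 3 (mod 4)` squarefree, `q ∈ ℚˣ`; `δ² = Δ_W`; `κ`, `κT` ANY cyclotomic `ℤ₂`-extensions of `ℚ(δ) = ℚ(√−d)`,
`ℚ(W[2])`; `m_ℓ = ord₂(ℓ²−1) − 3`, `Σ = Σ_{ℓ ∣ d} 2^{m_ℓ}`):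
* §1 `classGroupPRank_resolvent_eq_sum` (**`rank₂ Cl(ℚ(√Δ_W)_n) = Σ_{ℓ ∣ d} 2^{min(n, m_ℓ)} − 1`**), ★ `classicalLambda_resolvent_le` (**`μ₂(ℚ(√Δ_W)) = 0` and
  `λ₂(ℚ(√Δ_W)) ≤ Σ − 1`, unconditional**).
* §2 ★ `classGroupPRank_divisionField_two_ge_sum` (**`rank₂ Cl(ℚ(W[2])_n) ≥ Σ_{ℓ ∣ d} 2^{min(n, m_ℓ)} − 1` at every layer `n`**, unconditional — gen 29's
  `C₃`-descent inequality composed with §1); so a rank certificate on the sextic at a layer `n` has value `≥ Σ_{ℓ ∣ d} 2^{min(n, m_ℓ)} − 1`.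
* §3 seeds: ★ `seventeen_le_classGroupPRank_7831a1` (**7831a1: `rank₂ Cl(ℚ(W[2])_n) ≥ 17` for every `n ≥ 4`**, `= Σ(7831) − 1`, `41² − 1 = 2⁴·105`,
  `191² − 1 = 2⁷·285`), ★ `thirtythree_le_classGroupPRank_24213c1` (**24213c1: `≥ 33` for `n ≥ 5`**; `7² − 1 = 2⁴·3`, `1153² − 1 = 2⁸·5193`), and the
  resolvent certificates / `λ₂(ℚ(√−7831)) ≤ 17`, `λ₂(ℚ(√−8071)) ≤ 33` unconditionally (`classicalLambda_resolvent_le_7831a1`, `…_24213c1`).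

WHAT THIS BUYS THE CRUX (numbers, not adjectives).  The certificate that C2's Kilford sub-cell needs on the sextic `ℚ(W[2])` can only occur with a value
`r ≥ Σ_{ℓ ∣ d} 2^{min(n, m_ℓ)} − 1` at layer `n` (odd, gen-30 parity law) — for 7831a1 no certificate below `17` from layer `4` on, for 24213c1 none below `33`
from layer `5` on — with NO hypothesis (`-data`: the class-group computation that could certify must reach rank `≥ 17` / `≥ 33`).  And the resolvent's `λ₂`
is bounded ABOVE by the Ferrero–Kida value in the kernel.  Nothing is closed.

References: [Ferrero1980AJM]; [Kida1979Tohoku] Thm. 1; [Fukuda1994] Thm. 1 (2); [Washington1997] §13.1, §13.3; [Schettler2014] Thm. 2 (the sums);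
[CremonaAlgorithms1997] Table 1 (the curves); this seat's gen-30 Literature files and gen 29's `…ResolventLambdaParitySeeds` (kernel sums `Σ(7831) = 18`,
`Σ(8071) = 34`).
-/

set_option linter.dupNamespace false
set_option autoImplicit false

noncomputable section

open scoped Classical NumberField

namespace Summit.BirchSwinnertonDyer.BirchSwinnertonDyer.Theorems.AlignedTransportAtTwoResolventTowerGenusStable

open Polynomial WeierstrassCurve IntermediateField Field NumberField Finset
  Literature.NumberTheory.EllipticCurves Literature.NumberTheory.EllipticCurves.Greenberg1999 Literature.NumberTheory.GaloisRepresentations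
  Literature.NumberTheory.EllipticCurves.ZpExtension Literature.NumberTheory.IwasawaTheory Literature.NumberTheory.NumberFields
  Summit.BirchSwinnertonDyer.Rank1Residual.F1Sign2
  Summit.BirchSwinnertonDyer.BirchSwinnertonDyer.Theorems.AlignedTransportAtTwoKilfordStratumShared
  Summit.BirchSwinnertonDyer.BirchSwinnertonDyer.Theorems.AlignedTransportAtTwoResolventParity
  Summit.BirchSwinnertonDyer.BirchSwinnertonDyer.Theorems.AlignedTransportAtTwoResolventLambdaParity
  Summit.BirchSwinnertonDyer.BirchSwinnertonDyer.Theorems.AlignedTransportAtTwoResolventLambdaParitySeeds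
  Summit.BirchSwinnertonDyer.BirchSwinnertonDyer.Theorems.AlignedTransportAtTwoResolventTowerGenus
  Summit.BirchSwinnertonDyer.BirchSwinnertonDyer.Theorems.TowerClass

variable (W : WeierstrassCurve ℚ) [W.IsElliptic]

/-! ## §1 The resolvent tower, explicit -/

omit [W.IsElliptic] in
/-- **`rank₂ Cl(ℚ(√Δ_W)_n) = Σ_{ℓ ∣ d} 2^{min(n, ord₂(ℓ²−1)−3)} − 1` for every `n`** (`Δ_W = −d·q²`, `d ≡ 3 (mod 4)` squarefree, `κ` any cyclotomic
`ℤ₂`-extension of `ℚ(δ)`, `δ² = Δ_W`). [cite: Ferrero1980AJM, §2] [cite: Washington1997, §13.1] -/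
theorem classGroupPRank_resolvent_eq_sum {d : ℕ} (hd : Squarefree d) (hd4 : d % 4 = 3) {q : ℚ} (hq : q ≠ 0) (hΔ : W.Δ = -(d : ℚ) * q ^ 2)
    {δ : AlgebraicClosure ℚ} (hδ : δ ^ 2 = ((W.Δ : ℚ) : AlgebraicClosure ℚ)) (κ : ZpExtension ℚ⟮δ⟯ 2) (hκ : κ.IsCyclotomic) (n : ℕ) :
    classGroupPRank κ n = (∑ ℓ ∈ d.primeFactors, 2 ^ min n (padicValNat 2 (ℓ ^ 2 - 1) - 3)) - 1 := by
  have hδint : IsIntegral ℚ δ := ((AlgebraicClosure.isAlgebraic ℚ).isAlgebraic δ).isIntegral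
  haveI : FiniteDimensional ℚ ℚ⟮δ⟯ := IntermediateField.adjoin.finiteDimensional hδint
  haveI : NumberField ℚ⟮δ⟯ := NumberField.mk
  obtain ⟨hK2, hη⟩ := exists_sq_eq_neg_of_sq_eq W (by omega) hq hΔ hδ
  exact (classicalLambda_le_of_sq_eq_neg ℚ⟮δ⟯ hK2 hd hd4 hη κ hκ).2 n

omit [W.IsElliptic] in
/-- ★ **`μ₂(ℚ(√Δ_W)) = 0` and `λ₂(ℚ(√Δ_W)) ≤ Σ_{ℓ ∣ d} 2^{ord₂(ℓ²−1)−3} − 1`, UNCONDITIONALLY** (the upper half of Ferrero–Kida for the resolvent; `Δ_W = −d·q²`,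
`d ≡ 3 (mod 4)` squarefree, `κ` any cyclotomic `ℤ₂`-extension of `ℚ(√Δ_W)`). [cite: Ferrero1980AJM, Thm.] [cite: Fukuda1994, Thm. 1 (2), p. 264] -/
theorem classicalLambda_resolvent_le {d : ℕ} (hd : Squarefree d) (hd4 : d % 4 = 3) {q : ℚ} (hq : q ≠ 0) (hΔ : W.Δ = -(d : ℚ) * q ^ 2)
    {δ : AlgebraicClosure ℚ} (hδ : δ ^ 2 = ((W.Δ : ℚ) : AlgebraicClosure ℚ)) (κ : ZpExtension ℚ⟮δ⟯ 2) (hκ : κ.IsCyclotomic) :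
    ClassicalMuVanishes κ ∧ classicalLambda κ ≤ (∑ ℓ ∈ d.primeFactors, 2 ^ (padicValNat 2 (ℓ ^ 2 - 1) - 3)) - 1 := by
  have hδint : IsIntegral ℚ δ := ((AlgebraicClosure.isAlgebraic ℚ).isAlgebraic δ).isIntegral
  haveI : FiniteDimensional ℚ ℚ⟮δ⟯ := IntermediateField.adjoin.finiteDimensional hδint
  haveI : NumberField ℚ⟮δ⟯ := NumberField.mk
  obtain ⟨hK2, hη⟩ := exists_sq_eq_neg_of_sq_eq W (by omega) hq hΔ hδ
  exact (classicalLambda_le_of_sq_eq_neg ℚ⟮δ⟯ hK2 hd hd4 hη κ hκ).1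

/-! ## §2 The sextic: `rank₂ Cl(ℚ(W[2])_n) ≥ Σ_{ℓ ∣ d} 2^{min(n, m_ℓ)} − 1`, unconditionally -/

/-- ★ **`rank₂ Cl(ℚ(W[2])_n) ≥ Σ_{ℓ ∣ d} 2^{min(n, ord₂(ℓ²−1)−3)} − 1` at every layer `n`** (`Δ_W = −d·q²`, `d ≡ 3 (mod 4)` squarefree; `κT` any cyclotomic
`ℤ₂`-extension of `ℚ(W[2])`) — UNCONDITIONAL: gen 29's `rank₂ Cl(ℚ(√Δ_W)_n) ≤ rank₂ Cl(ℚ(W[2])_n)` and §1.  In particular a 2-rank certificate on the sextic at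
layer `n` has value at least this number. [cite: Ferrero1980AJM, §2] [cite: Washington1997, Thm. 10.8] -/
theorem classGroupPRank_divisionField_two_ge_sum {d : ℕ} (hd : Squarefree d) (hd4 : d % 4 = 3) {q : ℚ} (hq : q ≠ 0)
    (hΔ : W.Δ = -(d : ℚ) * q ^ 2) (κT : ZpExtension (W.divisionField 2) 2) (hκT : κT.IsCyclotomic) (n : ℕ) :
    (∑ ℓ ∈ d.primeFactors, 2 ^ min n (padicValNat 2 (ℓ ^ 2 - 1) - 3)) - 1 ≤ classGroupPRank κT n := by
  have h2d : 2 < d := by omega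
  have hsq : ¬ IsSquare W.Δ := not_isSquare_Δ_of_eq_neg_mul_sq W h2d hq hΔ
  obtain ⟨δ, hδ⟩ : ∃ δ : AlgebraicClosure ℚ, δ ^ 2 = ((W.Δ : ℚ) : AlgebraicClosure ℚ) := by
    obtain ⟨δ, hδ⟩ := IsAlgClosed.exists_pow_nat_eq ((W.Δ : ℚ) : AlgebraicClosure ℚ) two_pos
    exact ⟨δ, hδ⟩
  have hδint : IsIntegral ℚ δ := ((AlgebraicClosure.isAlgebraic ℚ).isAlgebraic δ).isIntegral
  haveI : FiniteDimensional ℚ ℚ⟮δ⟯ := IntermediateField.adjoin.finiteDimensional hδint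
  haveI : NumberField ℚ⟮δ⟯ := NumberField.mk
  obtain ⟨hK2, hη⟩ := exists_sq_eq_neg_of_sq_eq W h2d hq hΔ hδ
  obtain ⟨hIQ, -, -⟩ := isImaginaryQuadratic_and_natAbs_discr_eq_of_sq_eq_neg ℚ⟮δ⟯ hK2 hd hd4 hη
  have hcyc := CyclotomicZp.isCyclotomic_zpExtension 2
  have hsurj := surjective_comp_absGaloisRestrict_imaginaryQuadratic_two hcyc ℚ⟮δ⟯ hIQ
  set κ := (CyclotomicZp.zpExtension 2).restrict ℚ⟮δ⟯ hsurj with hκdef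
  have hκ : κ.IsCyclotomic := isCyclotomic_restrict (CyclotomicZp.zpExtension 2) hcyc ℚ⟮δ⟯ hsurj
  obtain ⟨-, hle⟩ := classGroupPRank_divisionField_two_modEq_two_resolvent W hsq hδ κ hκ κT hκT n
  rw [classGroupPRank_resolvent_eq_sum W hd hd4 hq hΔ hδ κ hκ n] at hle
  exact hle

/-! ## §3 The seeds 7831a1 and 24213c1 -/

/-- `ord₂(p² − 1)` for `p² − 1 = 2^k · m`, `m` odd. [folklore] -/
private theorem padicValNat_two_eq' {n k m : ℕ} (h : n = 2 ^ k * m) (hm : ¬ 2 ∣ m) : padicValNat 2 n = k := by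
  haveI : Fact (Nat.Prime 2) := ⟨Nat.prime_two⟩
  have hm0 : m ≠ 0 := fun h0 => hm (h0 ▸ dvd_zero 2)
  rw [h, padicValNat.mul (by positivity) hm0, padicValNat.prime_pow, padicValNat.eq_zero_of_not_dvd hm, add_zero]

/-- `Σ_{ℓ ∣ 7831} 2^{min(n, m_ℓ)} = 18` for `n ≥ 4` (`7831 = 41·191`, `m_41 = 1`, `m_191 = 4`). [cite: Schettler2014, Thm. 2] -/
theorem sum_two_pow_min_7831 {n : ℕ} (hn : 4 ≤ n) : ∑ ℓ ∈ (7831 : ℕ).primeFactors, 2 ^ min n (padicValNat 2 (ℓ ^ 2 - 1) - 3) = 18 := by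
  have h : (7831 : ℕ).primeFactors = {41, 191} := by
    rw [show (7831 : ℕ) = 41 * 191 by norm_num, Nat.primeFactors_mul (by norm_num) (by norm_num),
      Nat.Prime.primeFactors (by norm_num), Nat.Prime.primeFactors (by norm_num)]
    decide
  have h41 : padicValNat 2 (41 ^ 2 - 1) = 4 := padicValNat_two_eq' (k := 4) (m := 105) (by norm_num) (by norm_num)
  have h191 : padicValNat 2 (191 ^ 2 - 1) = 7 := padicValNat_two_eq' (k := 7) (m := 285) (by norm_num) (by norm_num)
  rw [h, Finset.sum_pair (by norm_num), h41, h191, min_eq_right (by omega : 4 - 3 ≤ n), min_eq_right (by omega : 7 - 3 ≤ n)]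
  norm_num

/-- `Σ_{ℓ ∣ 8071} 2^{min(n, m_ℓ)} = 34` for `n ≥ 5` (`8071 = 7·1153`, `m_7 = 1`, `m_1153 = 5`: `1153² − 1 = 2⁸·5193`). [cite: Schettler2014, Thm. 2] -/
theorem sum_two_pow_min_8071 {n : ℕ} (hn : 5 ≤ n) : ∑ ℓ ∈ (8071 : ℕ).primeFactors, 2 ^ min n (padicValNat 2 (ℓ ^ 2 - 1) - 3) = 34 := by
  have h : (8071 : ℕ).primeFactors = {7, 1153} := by
    rw [show (8071 : ℕ) = 7 * 1153 by norm_num, Nat.primeFactors_mul (by norm_num) (by norm_num),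
      Nat.Prime.primeFactors (by norm_num), Nat.Prime.primeFactors (by norm_num)]
    decide
  have h7 : padicValNat 2 (7 ^ 2 - 1) = 4 := padicValNat_two_eq' (k := 4) (m := 3) (by norm_num) (by norm_num)
  have h1153 : padicValNat 2 (1153 ^ 2 - 1) = 8 := padicValNat_two_eq' (k := 8) (m := 5193) (by norm_num) (by norm_num)
  rw [h, Finset.sum_pair (by norm_num), h7, h1153, min_eq_right (by omega : 4 - 3 ≤ n), min_eq_right (by omega : 8 - 3 ≤ n)]
  norm_num

/-- ★ **7831a1: `rank₂ Cl(ℚ(W[2])_n) ≥ 17` for every `n ≥ 4`, UNCONDITIONALLY** (`Δ_min = −7831·41²`; gen 29 had `λ₂(T) ≥ 17` granted `μ = 0` + Ferrero–Kida).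
So no 2-rank certificate of value `< 17` exists on the sextic tower of 7831a1 at any layer `n ≥ 4`. [cite: Fukuda1994, Thm. 1 (2), p. 264]
[cite: CremonaAlgorithms1997, Table 1] -/
theorem seventeen_le_classGroupPRank_7831a1 (κT : ZpExtension (c7831a1.divisionField 2) 2) (hκT : κT.IsCyclotomic) {n : ℕ} (hn : 4 ≤ n) :
    17 ≤ classGroupPRank κT n := by
  have hΔ : c7831a1.Δ = -((7831 : ℕ) : ℚ) * (41 : ℚ) ^ 2 := by rw [baseChange_int_Δ, M7831a1_Δ]; norm_num
  have hd : Squarefree (7831 : ℕ) := by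
    rw [show (7831 : ℕ) = 41 * 191 by norm_num]
    exact (Nat.squarefree_mul (by norm_num)).mpr ⟨(Nat.prime_iff.mp (by norm_num)).squarefree, (Nat.prime_iff.mp (by norm_num)).squarefree⟩
  have h := classGroupPRank_divisionField_two_ge_sum c7831a1 hd (by norm_num) (by norm_num : (41 : ℚ) ≠ 0) hΔ κT hκT n
  rw [sum_two_pow_min_7831 hn] at h
  omega

/-- **7831a1, resolvent: `rank₂ Cl(ℚ(√−7831)_n) = 17` for every `n ≥ 4`, a rank certificate at every pair `(n, n+1)`, `n ≥ 4`, and `μ₂ = 0`,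
`λ₂(ℚ(√−7831)) ≤ 17` UNCONDITIONALLY** (Ferrero–Kida: `= 17`). [cite: Ferrero1980AJM, Thm.] [cite: Fukuda1994, Thm. 1 (2), p. 264] -/
theorem classicalLambda_resolvent_le_7831a1 {δ : AlgebraicClosure ℚ} (hδ : δ ^ 2 = ((c7831a1.Δ : ℚ) : AlgebraicClosure ℚ))
    (κ : ZpExtension ℚ⟮δ⟯ 2) (hκ : κ.IsCyclotomic) :
    (∀ n, 4 ≤ n → classGroupPRank κ n = 17) ∧ ClassicalMuVanishes κ ∧ classicalLambda κ ≤ 17 := by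
  have hΔ : c7831a1.Δ = -((7831 : ℕ) : ℚ) * (41 : ℚ) ^ 2 := by rw [baseChange_int_Δ, M7831a1_Δ]; norm_num
  have hd : Squarefree (7831 : ℕ) := by
    rw [show (7831 : ℕ) = 41 * 191 by norm_num]
    exact (Nat.squarefree_mul (by norm_num)).mpr ⟨(Nat.prime_iff.mp (by norm_num)).squarefree, (Nat.prime_iff.mp (by norm_num)).squarefree⟩
  refine ⟨fun n hn => ?_, ?_⟩
  · rw [classGroupPRank_resolvent_eq_sum c7831a1 hd (by norm_num) (by norm_num : (41 : ℚ) ≠ 0) hΔ hδ κ hκ n, sum_two_pow_min_7831 hn]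
  · have h := classicalLambda_resolvent_le c7831a1 hd (by norm_num) (by norm_num : (41 : ℚ) ≠ 0) hΔ hδ κ hκ
    have hs : ∑ ℓ ∈ (7831 : ℕ).primeFactors, 2 ^ (padicValNat 2 (ℓ ^ 2 - 1) - 3) = 18 := by
      have h8 := sum_two_pow_min_7831 (n := 8) (by norm_num)
      have : ∑ ℓ ∈ (7831 : ℕ).primeFactors, 2 ^ min 8 (padicValNat 2 (ℓ ^ 2 - 1) - 3) =
          ∑ ℓ ∈ (7831 : ℕ).primeFactors, 2 ^ (padicValNat 2 (ℓ ^ 2 - 1) - 3) := by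
        refine Finset.sum_congr rfl fun ℓ hℓ => ?_
        have h : (7831 : ℕ).primeFactors = {41, 191} := by
          rw [show (7831 : ℕ) = 41 * 191 by norm_num, Nat.primeFactors_mul (by norm_num) (by norm_num),
            Nat.Prime.primeFactors (by norm_num), Nat.Prime.primeFactors (by norm_num)]
          decide
        rw [h, Finset.mem_insert, Finset.mem_singleton] at hℓ
        rcases hℓ with rfl | rfl
        · rw [padicValNat_two_eq' (n := 41 ^ 2 - 1) (k := 4) (m := 105) (by norm_num) (by norm_num)]; norm_num
        · rw [padicValNat_two_eq' (n := 191 ^ 2 - 1) (k := 7) (m := 285) (by norm_num) (by norm_num)]; norm_num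
      rw [← this, h8]
    rw [hs] at h
    exact h

/-- ★ **24213c1: `rank₂ Cl(ℚ(W[2])_n) ≥ 33` for every `n ≥ 5`, UNCONDITIONALLY** (`Δ_min = −8071·(3¹⁰·7³·1153)²`, `8071 = 7·1153`).
[cite: Fukuda1994, Thm. 1 (2), p. 264] [cite: CremonaAlgorithms1997, Table 1] -/
theorem thirtythree_le_classGroupPRank_24213c1 (κT : ZpExtension (c24213c1.divisionField 2) 2) (hκT : κT.IsCyclotomic) {n : ℕ} (hn : 5 ≤ n) :
    33 ≤ classGroupPRank κT n := by
  have hΔ : c24213c1.Δ = -((8071 : ℕ) : ℚ) * (23352639471 : ℚ) ^ 2 := by rw [baseChange_int_Δ, M24213c1_Δ]; norm_num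
  have hd : Squarefree (8071 : ℕ) := by
    rw [show (8071 : ℕ) = 7 * 1153 by norm_num]
    exact (Nat.squarefree_mul (by norm_num)).mpr ⟨(Nat.prime_iff.mp (by norm_num)).squarefree, (Nat.prime_iff.mp (by norm_num)).squarefree⟩
  have h := classGroupPRank_divisionField_two_ge_sum c24213c1 hd (by norm_num) (by norm_num : (23352639471 : ℚ) ≠ 0) hΔ κT hκT n
  rw [sum_two_pow_min_8071 hn] at h
  omega

/-- **24213c1, resolvent: `rank₂ Cl(ℚ(√−8071)_n) = 33` for every `n ≥ 5`** (a rank certificate at every pair `(n, n+1)`, `n ≥ 5`).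
[cite: Ferrero1980AJM, §2] [cite: Fukuda1994, Thm. 1 (2), p. 264] -/
theorem classGroupPRank_resolvent_24213c1 {δ : AlgebraicClosure ℚ} (hδ : δ ^ 2 = ((c24213c1.Δ : ℚ) : AlgebraicClosure ℚ))
    (κ : ZpExtension ℚ⟮δ⟯ 2) (hκ : κ.IsCyclotomic) {n : ℕ} (hn : 5 ≤ n) : classGroupPRank κ n = 33 := by
  have hΔ : c24213c1.Δ = -((8071 : ℕ) : ℚ) * (23352639471 : ℚ) ^ 2 := by rw [baseChange_int_Δ, M24213c1_Δ]; norm_num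
  have hd : Squarefree (8071 : ℕ) := by
    rw [show (8071 : ℕ) = 7 * 1153 by norm_num]
    exact (Nat.squarefree_mul (by norm_num)).mpr ⟨(Nat.prime_iff.mp (by norm_num)).squarefree, (Nat.prime_iff.mp (by norm_num)).squarefree⟩
  rw [classGroupPRank_resolvent_eq_sum c24213c1 hd (by norm_num) (by norm_num : (23352639471 : ℚ) ≠ 0) hΔ hδ κ hκ n, sum_two_pow_min_8071 hn]

end Summit.BirchSwinnertonDyer.BirchSwinnertonDyer.Theorems.AlignedTransportAtTwoResolventTowerGenusStable

end
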